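import Mathlib
import Summits.Ventures.HodgeRepro2.T5SchurMathlib
import Summits.Ventures.HodgeRepro2.T5UnitaryContragredient

/-!
# T5SchurBridge — the unitarity predicate of p2's file, and orthogonality of characters

Tier-5 support (seat p1, cell pub-hodge-repro2), third file of the Schur-orthogonality group
(`T5SchurOrthogonality` p394792, `T5SchurMathlib` p394891).

* `isUnitary_iff_isUnitaryRep`: the cell's `IsUnitary π` (p1) and p2's
  `T5UnitaryContragredient.IsUnitaryRep (toRep π)` are the same predicate — the two annexes
  describe the same unitary representations (read-only import of p2's file; nothing re-proved).
* `integral_character_mul_conj_eq_zero`: characters of two inequivalent irreducible continuous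
  unitary representations of a compact group are orthogonal, `∫ χ_π · conj χ_σ dμ = 0` — the
  character form of the «otherwise 0» case of Goodman–Wallach Lemma 4.3.3 (p. 208) / §7.3.4
  (p. 360), obtained by summing the matrix-coefficient relation over orthonormal bases.

Honest scope unchanged: compact groups only.
-/

noncomputable section

namespace Summit.Ventures.HodgeRepro2.T5SchurMathlib

open Summit.Ventures.HodgeRepro2.T5SchurOrthogonality
open MeasureTheory ComplexConjugate
open scoped InnerProductSpace

variable {G : Type*} [Group G]
variable {V W : Type*} [NormedAddCommGroup V] [InnerProductSpace ℂ V]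
  [NormedAddCommGroup W] [InnerProductSpace ℂ W]
variable (π : G →* (V →L[ℂ] V)) (σ : G →* (W →L[ℂ] W))

/-- The cell's `IsUnitary π` is p2's `T5UnitaryContragredient.IsUnitaryRep` of `toRep π`
(read-only import; the two predicates are the same formula). -/
theorem isUnitary_iff_isUnitaryRep :
    IsUnitary π ↔ T5UnitaryContragredient.IsUnitaryRep (toRep π) :=
  Iff.rfl

variable [TopologicalSpace G] [IsTopologicalGroup G] [MeasurableSpace G] [BorelSpace G]
  [CompactSpace G] [FiniteDimensional ℂ V] [FiniteDimensional ℂ W]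

/-- Characters of two inequivalent irreducible continuous unitary representations are orthogonal:
`∫ χ_π · conj χ_σ dμ = 0` (sum the matrix-coefficient relation over orthonormal bases). -/
theorem integral_character_mul_conj_eq_zero (μ : Measure G) [IsProbabilityMeasure μ]
    [μ.IsMulLeftInvariant] (hπ : Continuous π) (hσ : Continuous σ) (hσu : IsUnitary σ)
    [Representation.IsIrreducible (toRep π)] [Representation.IsIrreducible (toRep σ)]
    [IsEmpty (Representation.Equiv (toRep σ) (toRep π))] :
    ∫ g, character π g * conj (character σ g) ∂μ = 0 := by
  haveI : IsFiniteMeasureOnCompacts μ :=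
    isFiniteMeasure_iff_isFiniteMeasureOnCompacts_of_compactSpace.mp inferInstance
  let b := stdOrthonormalBasis ℂ V
  let c := stdOrthonormalBasis ℂ W
  have hint : ∀ (i : Fin (Module.finrank ℂ V)) (j : Fin (Module.finrank ℂ W)),
      Integrable (fun g => ⟪b i, π g (b i)⟫_ℂ * conj ⟪c j, σ g (c j)⟫_ℂ) μ := fun i j =>
    ((continuous_matrixCoefficient π hπ (b i) (b i)).mul
      (Complex.continuous_conj.comp
        (continuous_matrixCoefficient σ hσ (c j) (c j)))).integrable_of_hasCompactSupport
      (HasCompactSupport.of_compactSpace _)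
  simp_rw [character_eq_sum π b, character_eq_sum σ c, map_sum, Finset.sum_mul_sum]
  rw [integral_finsetSum _ (fun i _ => integrable_finsetSum _ (fun j _ => hint i j))]
  simp_rw [integral_finsetSum _ (fun j _ => hint _ j),
    integral_inner_mul_conj_eq_zero_of_isEmpty_equiv π σ μ hπ hσ hσu]
  simp

end Summit.Ventures.HodgeRepro2.T5SchurMathlib
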